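import Summits.QuantumFields.YangMills.Theorems.LuscherReductionTwistedTraceScalingRecordAnalytic
import HarnessLib

/-!
# R37 — the EXPONENT WINDOW of lane A's hand-off objects: `RecordBOInput L s K M` / `RecordAnalyticInput L s M` are UNINHABITED unless `1/6 < s ≤ 1/5`
# (rate-and-radius bookkeeping guard, crux `TwistedTraceScaling`, stmt-QuantumFields-20203; companion of R36b `…Negative.RecordInputFatRadius`)

`RecordBOInput L s K M` (`…RecordBricks`, p650161) and the hand-off object `RecordAnalyticInput L s M` (`…RecordAnalytic`, p652422) carry the RATE fields
`hκ_dom : ∀ C, ∀ᶠ β, C·(Kβ^{-s})² ≤ κ β` (the induced-potential / frozen-profile error `Cδ²` must fit under `κ`) and `hκ_small : ∀ a > 0, ∀ᶠ β, κ β ≤ a·λ_b(L³β)`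
(`κ = o(λ_b)`, `λ_b(B) = (2/B)^{1/3}`), and `RecordBOInput` also the RADIUS fields `hcore : 13(L³β)^{-1/5} < δ₁ β`, `hradii : |Edge 3 L|·(4 r β + δ₁ β) < K·β^{-s}` eventually.
Read literally these force the exponent window by themselves:
* ★ `sixth_lt_of_rate_window` — `hκ_dom ∧ hκ_small` with `K ≠ 0` ⇒ **`1/6 < s`** (at `β ≥ 1`: `3β^{-2s} ≤ κ ≤ λ_b(L³β) ≤ 2β^{-1/3} ≤ 2β^{-2s}` is absurd for `s ≤ 1/6`);
  hence ★ `sixth_lt_of_recordInput`, ★ `sixth_lt_of_recordAnalyticInput`, `isEmpty_recordInput_of_le_sixth`, `isEmpty_recordAnalyticInput_of_le_sixth`;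
* ★ `le_fifth_of_recordInput` — `hcore ∧ hradii ∧ hr` ⇒ **`s ≤ 1/5`** for every `K` (`13|Edge|(L³)^{-1/5}·β^{s-1/5} < K` eventually, and `β^{s-1/5} → ∞` if `s > 1/5`);
* ★ `sq_lt_of_recordInput_of_fifth_le` — at `s ≥ 1/5` they force `39·L² < K`; so for the record factor `K = 43` (or any `K ≤ 156`) and `L ≥ 2`: **`s < 1/5`**
  (`lt_fifth_of_recordInput`), and ★ `window_of_recordInput` : `1/6 < s ∧ s < 1/5`.
CONSEQUENCE (vacuity ranges, by kernel): `innerNoIntruderOneOrbitAt_of_recordInput` (stated for `0 < s ≤ 1/3`, `K ≥ 1`) has an inhabited hypothesis only for `s ∈ (1/6, 1/5]`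
(`(1/6, 1/5)` when `K ≤ 156`, `L ≥ 2`), and `innerNoIntruderOneOrbitAt_of_analyticInput` (stated for `0 < s < 1/5`) only for `s ∈ (1/6, 1/5)` — exactly the window lane A's
COARSE-DESIGN §24.10 announces in prose; outside it both ★★★ theorems are vacuous.  Nothing here bears on whether the window itself is inhabited (that is the analysis (B-T),
(B-ST), (B-OD)).
HONEST FRAMING: necessary conditions on the parameters of lane A's input structures; refutes no registered statement, not C4-CORE(s) for s ∈ (1/6, 1/5); stub of a child of
the CONDITIONAL reduction route R2b1; not a gap, not Clay.
-/

set_option autoImplicit false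

noncomputable section

open MeasureTheory Filter Topology Real
open scoped BigOperators
open Literature.MathematicalPhysics.QuantumFieldTheory hiding SU2
open Literature.MathematicalPhysics.QuantumLattice

namespace Summit.QuantumFields.YangMills.Theorems.TwistedTraceScaling.Negative.R37

open Summit.QuantumFields.YangMills.Theorems.FemtoTransferGap
open Summit.QuantumFields.YangMills.Theorems.FemtoTransferGap.TwoLattice.ConstTube
open Summit.QuantumFields.YangMills.Theorems.TwistedTraceScaling.Negative.R36 (card_edge_eq)

variable {L : ℕ} [NeZero L]

/-! ## §1 The rate fields force `s > 1/6` -/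

/-- `1 ≤ (L:ℝ)³`. [folklore] -/
theorem one_le_cube : (1 : ℝ) ≤ (L : ℝ) ^ 3 := one_le_pow₀ (by exact_mod_cast NeZero.one_le)

/-- `λ_b(L³β) ≤ 2·β^{-1/3}` for `β ≥ 1` (`(2/(L³β))^{1/3} ≤ (8/β)^{1/3}`). [folklore] -/
theorem bareLambda_cube_mul_le {β : ℝ} (hβ : 1 ≤ β) : bareLambda ((L : ℝ) ^ 3 * β) ≤ 2 * β ^ (-(1 / 3 : ℝ)) := by
  have hβ0 : 0 < β := by linarith
  have hL := one_le_cube (L := L)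
  have h1 : 2 / ((L : ℝ) ^ 3 * β) ≤ 8 * β⁻¹ := by
    rw [div_le_iff₀ (by positivity)]
    have e : 8 * β⁻¹ * ((L : ℝ) ^ 3 * β) = 8 * (L : ℝ) ^ 3 := by field_simp
    rw [e]; nlinarith
  have h8 : (8 : ℝ) ^ ((1 : ℝ) / 3) = 2 := by
    rw [show (8 : ℝ) = (2 : ℝ) ^ (3 : ℕ) by norm_num, show ((1 : ℝ) / 3) = ((3 : ℕ) : ℝ)⁻¹ by norm_num]
    exact Real.pow_rpow_inv_natCast (by norm_num) (by norm_num)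
  unfold bareLambda
  calc (2 / ((L : ℝ) ^ 3 * β)) ^ ((1 : ℝ) / 3) ≤ (8 * β⁻¹) ^ ((1 : ℝ) / 3) := Real.rpow_le_rpow (by positivity) h1 (by norm_num)
    _ = (8 : ℝ) ^ ((1 : ℝ) / 3) * β⁻¹ ^ ((1 : ℝ) / 3) := Real.mul_rpow (by norm_num) (by positivity)
    _ = 2 * β ^ (-(1 / 3 : ℝ)) := by rw [h8, Real.inv_rpow hβ0.le, Real.rpow_neg hβ0.le]

/-- ★ **R37-1.**  The two rate fields `hκ_dom` (every `C·(Kβ^{-s})²` fits under `κ`) and `hκ_small` (`κ = o(λ_b(L³β))`) are jointly satisfiable only if `s > 1/6` (`K ≠ 0`).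
[folklore] -/
theorem sixth_lt_of_rate_window {s K : ℝ} (hK : K ≠ 0) {κ : ℝ → ℝ}
    (hdom : ∀ C : ℝ, ∀ᶠ β in atTop, C * (K * powScale s β) ^ 2 ≤ κ β)
    (hsmall : ∀ a : ℝ, 0 < a → ∀ᶠ β in atTop, κ β ≤ a * bareLambda ((L : ℝ) ^ 3 * β)) : 1 / 6 < s := by
  by_contra hs
  rw [not_lt] at hs
  obtain ⟨β, hβ1, hd, hsm⟩ := ((eventually_ge_atTop (1 : ℝ)).and ((hdom (3 / K ^ 2)).and (hsmall 1 one_pos))).exists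
  have hβ0 : 0 < β := by linarith
  have hp : powScale s β = β ^ (-s) := powScale_eq hβ1
  -- `β^{-1/3} ≤ (β^{-s})²` for `s ≤ 1/6`
  have hp6 : β ^ (-(1 / 6 : ℝ)) ≤ β ^ (-s) := Real.rpow_le_rpow_of_exponent_le hβ1 (by linarith)
  have hq0 : 0 < β ^ (-(1 / 6 : ℝ)) := Real.rpow_pos_of_pos hβ0 _
  have h13 : β ^ (-(1 / 3 : ℝ)) = β ^ (-(1 / 6 : ℝ)) * β ^ (-(1 / 6 : ℝ)) := by rw [← Real.rpow_add hβ0]; norm_num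
  have hsq : β ^ (-(1 / 3 : ℝ)) ≤ (β ^ (-s)) ^ 2 := by
    rw [h13, sq]; exact mul_le_mul hp6 hp6 hq0.le (hq0.le.trans hp6)
  -- the two rate inequalities at this `β`
  have e : 3 / K ^ 2 * (K * powScale s β) ^ 2 = 3 * (β ^ (-s)) ^ 2 := by rw [hp]; field_simp
  have hd' : 3 * (β ^ (-s)) ^ 2 ≤ κ β := e ▸ hd
  have hsm' : κ β ≤ 2 * β ^ (-(1 / 3 : ℝ)) := by
    have := bareLambda_cube_mul_le (L := L) hβ1; rw [one_mul] at hsm; linarith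
  have hpos : 0 < (β ^ (-s)) ^ 2 := by positivity
  linarith

/-- ★ **R37-2.**  `RecordBOInput L s K M` (`K ≠ 0`) is inhabited only if `s > 1/6`. [folklore] -/
theorem sixth_lt_of_recordInput {s K M : ℝ} (hK : K ≠ 0) (I : RecordBOInput L s K M) : 1 / 6 < s :=
  sixth_lt_of_rate_window (L := L) hK I.hκ_dom I.hκ_small

/-- ★ **R37-3.**  The hand-off object `RecordAnalyticInput L s M` is inhabited only if `s > 1/6`. [folklore] -/
theorem sixth_lt_of_recordAnalyticInput {s M : ℝ} (A : RecordAnalyticInput L s M) : 1 / 6 < s :=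
  sixth_lt_of_rate_window (L := L) (by norm_num : (43 : ℝ) ≠ 0) A.hκ_dom A.hκ_small

/-- R37-4.  `RecordBOInput L s K M` is empty for `s ≤ 1/6` (`K ≠ 0`): there `innerNoIntruderOneOrbitAt_of_recordInput` is vacuous. [folklore] -/
theorem isEmpty_recordInput_of_le_sixth {s K M : ℝ} (hK : K ≠ 0) (hs : s ≤ 1 / 6) : IsEmpty (RecordBOInput L s K M) :=
  ⟨fun I => absurd (sixth_lt_of_recordInput hK I) (not_lt.mpr hs)⟩

/-- R37-5.  `RecordAnalyticInput L s M` is empty for `s ≤ 1/6`: there `innerNoIntruderOneOrbitAt_of_analyticInput` is vacuous. [folklore] -/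
theorem isEmpty_recordAnalyticInput_of_le_sixth {s M : ℝ} (hs : s ≤ 1 / 6) : IsEmpty (RecordAnalyticInput L s M) :=
  ⟨fun A => absurd (sixth_lt_of_recordAnalyticInput A) (not_lt.mpr hs)⟩

/-! ## §2 The radius fields force `s ≤ 1/5` (and `s < 1/5` unless `K > 39L²`) -/

/-- The radius fields at one `β ≥ 1`: `hcore ∧ hradii ∧ r ≥ 0` give `13·|Edge 3 L|·(L³)^{-1/5}·β^{s-1/5} < K`. [folklore] -/
theorem radius_ineq_at {s K : ℝ} {r δ₁ : ℝ} {β : ℝ} (hβ : 1 ≤ β) (hr : 0 ≤ r)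
    (hcore : 13 * ((L : ℝ) ^ 3 * β) ^ (-(1 / 5 : ℝ)) < δ₁) (hradii : (Fintype.card (Edge 3 L) : ℝ) * (4 * r + δ₁) < K * powScale s β) :
    13 * Fintype.card (Edge 3 L) * ((L : ℝ) ^ 3) ^ (-(1 / 5 : ℝ)) * β ^ (s - 1 / 5) < K := by
  have hβ0 : 0 < β := by linarith
  have hL := one_le_cube (L := L)
  have hE : (0 : ℝ) ≤ Fintype.card (Edge 3 L) := Nat.cast_nonneg _
  have hp : powScale s β = β ^ (-s) := powScale_eq hβ
  have hps : 0 < β ^ (-s) := Real.rpow_pos_of_pos hβ0 _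
  -- `(L³β)^{-1/5} = (L³)^{-1/5}·β^{s-1/5}·β^{-s}`
  have hsplit : ((L : ℝ) ^ 3 * β) ^ (-(1 / 5 : ℝ)) = ((L : ℝ) ^ 3) ^ (-(1 / 5 : ℝ)) * (β ^ (s - 1 / 5) * β ^ (-s)) := by
    rw [Real.mul_rpow (by positivity) hβ0.le, ← Real.rpow_add hβ0, show s - 1 / 5 + -s = -(1 / 5 : ℝ) by ring]
  have h1 : (Fintype.card (Edge 3 L) : ℝ) * δ₁ ≤ Fintype.card (Edge 3 L) * (4 * r + δ₁) := by nlinarith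
  have h2 : (Fintype.card (Edge 3 L) : ℝ) * (13 * ((L : ℝ) ^ 3 * β) ^ (-(1 / 5 : ℝ))) ≤ Fintype.card (Edge 3 L) * δ₁ :=
    mul_le_mul_of_nonneg_left hcore.le hE
  have h3 : (Fintype.card (Edge 3 L) : ℝ) * (13 * ((L : ℝ) ^ 3 * β) ^ (-(1 / 5 : ℝ))) < K * β ^ (-s) := by
    rw [← hp]; exact lt_of_le_of_lt (h2.trans h1) hradii
  rw [hsplit] at h3
  have h4 : (13 * Fintype.card (Edge 3 L) * ((L : ℝ) ^ 3) ^ (-(1 / 5 : ℝ)) * β ^ (s - 1 / 5)) * β ^ (-s) < K * β ^ (-s) := by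
    have e : (13 * Fintype.card (Edge 3 L) * ((L : ℝ) ^ 3) ^ (-(1 / 5 : ℝ)) * β ^ (s - 1 / 5)) * β ^ (-s) =
        (Fintype.card (Edge 3 L) : ℝ) * (13 * (((L : ℝ) ^ 3) ^ (-(1 / 5 : ℝ)) * (β ^ (s - 1 / 5) * β ^ (-s)))) := by ring
    rw [e]; exact h3
  exact lt_of_mul_lt_mul_right h4 hps.le

/-- ★ **R37-6.**  `RecordBOInput L s K M` is inhabited only if `s ≤ 1/5` (any `K`): `hcore ∧ hradii` give `c·β^{s-1/5} < K` eventually with `c > 0`, and `β^{s-1/5} → ∞` for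
`s > 1/5`. [folklore] -/
theorem le_fifth_of_recordInput {s K M : ℝ} (I : RecordBOInput L s K M) : s ≤ 1 / 5 := by
  by_contra hs
  rw [not_le] at hs
  have hL := one_le_cube (L := L)
  set c : ℝ := 13 * Fintype.card (Edge 3 L) * ((L : ℝ) ^ 3) ^ (-(1 / 5 : ℝ)) with hc
  have hE : (0 : ℝ) < Fintype.card (Edge 3 L) := by exact_mod_cast Fintype.card_pos
  have hc0 : 0 < c := by rw [hc]; positivity
  have ht : Tendsto (fun β : ℝ => β ^ (s - 1 / 5)) atTop atTop := tendsto_rpow_atTop (by linarith)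
  obtain ⟨β, hβ1, hbig, hcore, hrad⟩ :=
    ((eventually_ge_atTop (1 : ℝ)).and ((ht.eventually_ge_atTop (|K| / c + 1)).and (I.hcore.and I.hradii))).exists
  have hlt := radius_ineq_at (L := L) hβ1 (I.hr β).1 hcore hrad
  have hge : c * (|K| / c + 1) ≤ c * β ^ (s - 1 / 5) := mul_le_mul_of_nonneg_left hbig hc0.le
  have e : c * (|K| / c + 1) = |K| + c := by field_simp
  have hK : K ≤ |K| := le_abs_self K
  have : c * β ^ (s - 1 / 5) < K := hlt
  linarith

/-- `(L³)^{-1/5} ≥ L⁻¹` (`L ≥ 1`). [folklore] -/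
theorem inv_le_cube_rpow : ((L : ℝ))⁻¹ ≤ ((L : ℝ) ^ 3) ^ (-(1 / 5 : ℝ)) := by
  have hL1 : (1 : ℝ) ≤ (L : ℝ) := by exact_mod_cast NeZero.one_le
  have hL0 : (0 : ℝ) ≤ (L : ℝ) := by linarith
  have hL := one_le_cube (L := L)
  have h13 : ((L : ℝ) ^ 3) ^ (-(1 / 3 : ℝ)) = ((L : ℝ))⁻¹ := by
    rw [Real.rpow_neg (by positivity), show ((1 : ℝ) / 3) = ((3 : ℕ) : ℝ)⁻¹ by norm_num, Real.pow_rpow_inv_natCast hL0 (by norm_num)]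
  rw [← h13]
  exact Real.rpow_le_rpow_of_exponent_le hL (by norm_num)

/-- ★ **R37-7.**  At `s ≥ 1/5` the radius fields force `39·L² < K` (`|Edge 3 L| = 3L³`, `(L³)^{-1/5} ≥ 1/L`, `β^{s-1/5} ≥ 1`). [folklore] -/
theorem sq_lt_of_recordInput_of_fifth_le {s K M : ℝ} (I : RecordBOInput L s K M) (hs : 1 / 5 ≤ s) : 39 * (L : ℝ) ^ 2 < K := by
  have hL1 : (1 : ℝ) ≤ (L : ℝ) := by exact_mod_cast NeZero.one_le
  have hL0 : (0 : ℝ) < (L : ℝ) := by linarith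
  obtain ⟨β, hβ1, hcore, hrad⟩ := ((eventually_ge_atTop (1 : ℝ)).and (I.hcore.and I.hradii)).exists
  have hlt := radius_ineq_at (L := L) hβ1 (I.hr β).1 hcore hrad
  have hb1 : 1 ≤ β ^ (s - 1 / 5) := Real.one_le_rpow hβ1 (by linarith)
  have hcard : (Fintype.card (Edge 3 L) : ℝ) = 3 * (L : ℝ) ^ 3 := by
    rw [card_edge_eq, Fintype.card_pi, Finset.prod_const, Finset.card_univ, Fintype.card_fin, ZMod.card]; push_cast; ring
  have hinv := inv_le_cube_rpow (L := L)
  -- `39 L² = 13·3L³·L⁻¹·1 ≤ 13·|Edge|·(L³)^{-1/5}·β^{s-1/5} < K`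
  have h1 : 13 * (3 * (L : ℝ) ^ 3) * ((L : ℝ))⁻¹ ≤ 13 * (3 * (L : ℝ) ^ 3) * ((L : ℝ) ^ 3) ^ (-(1 / 5 : ℝ)) :=
    mul_le_mul_of_nonneg_left hinv (by positivity)
  have h0 : 0 ≤ 13 * (3 * (L : ℝ) ^ 3) * ((L : ℝ) ^ 3) ^ (-(1 / 5 : ℝ)) := by positivity
  have h2 : 13 * (3 * (L : ℝ) ^ 3) * ((L : ℝ) ^ 3) ^ (-(1 / 5 : ℝ)) * 1 ≤ 13 * (3 * (L : ℝ) ^ 3) * ((L : ℝ) ^ 3) ^ (-(1 / 5 : ℝ)) * β ^ (s - 1 / 5) :=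
    mul_le_mul_of_nonneg_left hb1 h0
  have e : 13 * (3 * (L : ℝ) ^ 3) * ((L : ℝ))⁻¹ = 39 * (L : ℝ) ^ 2 := by field_simp; ring
  rw [hcard] at hlt
  linarith

/-- R37-8.  Hence for `K ≤ 39L²` — in particular the record factor `K = 43` (or any `K ≤ 156`) with `L ≥ 2` — `RecordBOInput L s K M` is inhabited only if `s < 1/5`. [folklore] -/
theorem lt_fifth_of_recordInput (hL2 : 2 ≤ L) {s K M : ℝ} (hK : K ≤ 156) (I : RecordBOInput L s K M) : s < 1 / 5 := by
  by_contra hs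
  rw [not_lt] at hs
  have h := sq_lt_of_recordInput_of_fifth_le I hs
  have hL : (2 : ℝ) ≤ (L : ℝ) := by exact_mod_cast hL2
  nlinarith

/-- ★ **R37-9.**  THE WINDOW: for `L ≥ 2` and `0 < K ≤ 156` (e.g. the record `K = 43`), `RecordBOInput L s K M` is inhabited only if `1/6 < s < 1/5`; the range `0 < s ≤ 1/3` of
`innerNoIntruderOneOrbitAt_of_recordInput` is live only there. [folklore] -/
theorem window_of_recordInput (hL2 : 2 ≤ L) {s K M : ℝ} (hK0 : K ≠ 0) (hK : K ≤ 156) (I : RecordBOInput L s K M) : 1 / 6 < s ∧ s < 1 / 5 :=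
  ⟨sixth_lt_of_recordInput hK0 I, lt_fifth_of_recordInput hL2 hK I⟩

/-- R37-10.  Outside the window the record input is empty (`L ≥ 2`, `0 < K ≤ 156`). [folklore] -/
theorem isEmpty_recordInput_of_not_window (hL2 : 2 ≤ L) {s K M : ℝ} (hK0 : K ≠ 0) (hK : K ≤ 156) (hs : s ≤ 1 / 6 ∨ 1 / 5 ≤ s) :
    IsEmpty (RecordBOInput L s K M) :=
  ⟨fun I => by
    obtain ⟨h1, h2⟩ := window_of_recordInput hL2 hK0 hK I
    rcases hs with hs | hs <;> linarith⟩

/-- R37-11.  For the analytic hand-off object the extension `toRecordBOInput` is only ever invoked inside the window: `RecordAnalyticInput L s M` inhabited and `s < 1/5`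
(the theorem's hypothesis) already give `1/6 < s < 1/5`. [folklore] -/
theorem window_of_recordAnalyticInput {s M : ℝ} (A : RecordAnalyticInput L s M) (hs5 : s < 1 / 5) : 1 / 6 < s ∧ s < 1 / 5 :=
  ⟨sixth_lt_of_recordAnalyticInput A, hs5⟩

end Summit.QuantumFields.YangMills.Theorems.TwistedTraceScaling.Negative.R37

end
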